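import Summits.HodgeConjecture.HodgeConjecture.Theorems.MarkmanPartnerTransportIsotropicClassesOrthogonal
import Literature.AlgebraicGeometry.HodgeTheory.AlgebraicClassesPullbackHolds
import Mathlib.LinearAlgebra.BilinearForm.Orthogonal
import HarnessLib

/-!
# Orphan levers, T2⁺ «ISO-ALG»: `σσ̄`-isotropic rational `(2,2)`-classes on a projective `K3^{[2]}`-type
# fourfold lie in `N¹(X)·N¹(X) + ℂ q^∨` — in particular they are ALGEBRAIC

Sub-problem `HodgeConjecture`, route MarkmanPartnerTransport, rung «ORPHAN-RM» (memo ROUTE-P1AJ §B; the consequence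
«`λ ∈ Sym² N¹(X) + ℂ q^∨`» announced in the header of `Sketch_P1AJ_OrphanLevers_g37`, cell hodge-nonav).
Sequel to `…IsotropicClassesOrthogonal` (T2). For a marked smooth projective `K3^{[2]}`-type fourfold
`(X, φ, P, z)` and a RATIONAL class `λ ∈ H⁴(X(ℂ); ℂ)` of Hodge type `(2,2)` with `λ ∪ σ ∪ σ̄ = 0`:

* `classEndomorphism_eq_zero_of_orthogonal` — the class endomorphism `F_λ` kills `N¹(X)^{⊥_q}` (`im F_λ ⊆ N¹`
  by T2 and self-adjointness);
* `isotropicClass_mem_algebraicClasses` (**T2⁺**) — `λ ∈ A²(X)`, modulo {Verbitsky–Guan, O'Grady 2008}.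
  Proof: choose a basis `dₖ` of `N = N¹(X)_ℂ` and write `F_λ = Σₖ q(aₖ, ·) dₖ` (Riesz for the non-degenerate
  `q` on `H²`); `aₖ ∈ N^{⊥⊥} = N` (`LinearMap.BilinForm.orthogonal_orthogonal`) because `F_λ` kills `N^⊥`;
  the algebraic class `λ' = Σₖ aₖ ∪ dₖ` (products of divisor classes — tree theorem `Voisin2003_cupProduct_algebraicClasses_holds'`) has cubic form
  `(λ' ∪ y) ∪ w = (c·q(y,w) + 2 q(F_λ y, w))·P`, `c = Σ q(aₖ, dₖ)` (polarised Fujiki `cupFour_eq_of_isMarkedK3Hilb`,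
  self-adjointness), O'Grady's algebraic `q^∨` has `(q^∨ ∪ y) ∪ w = 25 q(y,w)·P`, so `½λ' − (c/50) q^∨` has the
  cubic form of `λ`, and a degree-`4` class is determined by its cubic form (`eq_of_cup3_eq`, Verbitsky–Guan +
  Poincaré duality).

Reading: no `σσ̄`-isotropic rational Hodge class (e.g. the class of a Lagrangian surface) carries information
beyond divisors and `q^∨`; the open content of HC⁴(X) is concentrated on classes pairing non-trivially with
`σσ̄`. CONDITIONAL on the two named facts displayed; no definition, no sorry; credits nothing to the Hodge
conjecture beyond this (classically expected) sector. Prover seat hodge-nonav-20241-p1 (gen 13),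
`--supports stmt-HodgeConjecture-19653`.

References: K. O'Grady, Commun. Contemp. Math. 10 (2008) §2–3; S. Novario, Kyoto J. Math. 66 (2026) Props.
4.1–4.4; C. Voisin, *Hodge Theory I* §7.1, Thm. 11.30; C. Voisin, *Hodge Theory II* Prop. 9.20.
-/

noncomputable section

set_option linter.dupNamespace false

open scoped Matrix
open Module CategoryTheory
open Literature.AlgebraicTopology.SingularHomology Literature.Geometry.Kaehler
open Literature.AlgebraicGeometry Literature.AlgebraicGeometry.Motives Literature.AlgebraicGeometry.HodgeTheory
open Literature.AlgebraicGeometry.Hyperkaehler Literature.AlgebraicGeometry.Surfaces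
open Summit.HodgeConjecture.HodgeConjecture.Theorems.NikulinTwinTransport
open Summit.HodgeConjecture.HodgeConjecture.Theorems.MarkmanPartnerTransport.BBFPositivity

namespace Summit.HodgeConjecture.HodgeConjecture.Theorems.MarkmanPartnerTransport.PartnerLattice

/-- `MarkedK3Sq[X, φ, P, z]`: VERBATIM the `let MarkedK3Sq := …` binder of the route declarations of
MarkmanPartnerTransport (clauses (m1)–(m6)). Local notation only. -/
local notation3 (prettyPrint := false) "MarkedK3Sq[" X ", " φ ", " P ", " z "]" =>
  (((IsIntegralClass P ∧ ∀ Q : complexBetti X (2 * 4), IsIntegralClass Q → ∃ n : ℤ, Q = n • P) ∧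
    (∀ c : complexBetti X 2, IsIntegralClass c ↔ ∃ v : K3HilbertIndex → ℤ, φ c = fun i => (v i : ℂ)) ∧
    (∀ a : complexBetti X 2, cupPowTwo a 4 = ((3 : ℂ) * (k3HilbertForm 2 (φ a) (φ a)) ^ 2) • P) ∧
    (IsOfHodgeType 4 X 2 2 0 (LinearEquiv.symm φ z) ∧
      ∀ τ : complexBetti X 2, IsOfHodgeType 4 X 2 2 0 τ → ∃ t : ℂ, τ = t • LinearEquiv.symm φ z) ∧
    (∀ c : complexBetti X 2, IsOfHodgeType 4 X 2 1 1 c ↔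
      (k3HilbertForm 2 (φ c) z = 0 ∧ k3HilbertForm 2 (φ c) (star z) = 0)) ∧
    (k3HilbertForm 2 z z = 0 ∧ 0 < (k3HilbertForm 2 (star z) z).re)))

/-- `qC` = the complex Beauville–Bogomolov form on `ℂ²³` as a Mathlib bilinear form. Local notation only. -/
local notation3 (prettyPrint := false) "qC" => Matrix.toBilin' (Matrix.map (k3HilbertGram 2) (Int.cast : ℤ → ℂ))

/-- `Cup3[c, y, w] = (c ∪ y) ∪ w ∈ H⁸` for `c ∈ H⁴`, `y, w ∈ H²`. Local notation only. -/
local notation3 (prettyPrint := false) "Cup3[" c ", " y ", " w "]" =>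
  cupProduct (rfl : 2 * 3 + 2 = 2 * 4) (cupProduct (rfl : 2 * 2 + 2 = 2 * 3) c y) w

variable {X : SchemeOver ℂ} {φ : complexBetti X 2 ≃ₗ[ℂ] (K3HilbertIndex → ℂ)} {P : complexBetti X (2 * 4)}
  {z : K3HilbertIndex → ℂ} {c : complexBetti X (2 * 2)} {F : complexBetti X 2 →ₗ[ℂ] complexBetti X 2}

/-! ### `F_c` kills the `q`-orthogonal complement of `N¹(X)` -/

/-- **`F_c t = 0` for `t ⟂_q N¹(X)`** when `c` is a rational `σσ̄`-isotropic `(2,2)`-class: `q(F_c t, w) = q(t, F_c w)`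
and `F_c w ∈ N¹(X)_ℂ` (`classEndomorphism_mem_algebraicClasses`); `q` is non-degenerate.
[cite: VoisinHodgeI2002, §7.1.2] [cite: OGrady2008NumericalK3Square, §2.1] -/
theorem classEndomorphism_eq_zero_of_orthogonal (hX : IsSmoothProjective 4 X) (hM : MarkedK3Sq[X, φ, P, z])
    (hF : ∀ y w : complexBetti X 2, Cup3[c, y, w] = (k3HilbertForm 2 (φ (F y)) (φ w)) • P)
    (hc : IsRationalClass c) (hc22 : IsOfHodgeType 4 X (2 * 2) 2 2 c)
    (hiso : Cup3[c, (LinearEquiv.symm φ) z, (LinearEquiv.symm φ) (star z)] = 0) {t : complexBetti X 2}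
    (ht : ∀ e : complexBetti X 2, e ∈ algebraicClasses X 1 → k3HilbertForm 2 (φ t) (φ e) = 0) :
    F t = 0 := by
  have h0 : ∀ w : complexBetti X 2, k3HilbertForm 2 (φ (F t)) (φ w) = 0 := fun w => by
    rw [classEndomorphism_selfAdjoint hX hM hF,
      ht _ (classEndomorphism_mem_algebraicClasses hX hM hF hc hc22 hiso w)]
  have hφ : φ (F t) = 0 := by
    refine qC_nondegenerate.1 _ fun v => ?_
    have h := h0 (φ.symm v)
    rw [LinearEquiv.apply_symm_apply] at h
    rw [qC_apply, h]
  exact φ.injective (by rw [hφ, map_zero])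

/-! ### (T2⁺) ISO-ALG -/

/-- **(T2⁺) `σσ̄`-isotropic rational `(2,2)`-classes are algebraic.** For a marked smooth projective
`K3^{[2]}`-type fourfold and a RATIONAL `λ ∈ H⁴(X)` of type `(2,2)` with `λ ∪ σ ∪ σ̄ = 0`: `λ ∈ A²(X)` — indeed
`λ = ½ Σₖ aₖ ∪ dₖ − (c/50)·q^∨` with `aₖ, dₖ ∈ N¹(X)_ℂ` (`F_λ = Σ q(aₖ,·) dₖ`, `aₖ ∈ N¹^{⊥⊥} = N¹`), by the
cubic forms (polarised Fujiki, O'Grady's `⟨q^∨, yw⟩ = 25 q(y,w)`) and uniqueness (`eq_of_cup3_eq`).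
Modulo {Verbitsky–Guan, O'Grady 2008}. [cite: OGrady2008NumericalK3Square, §2.2 Remark 2.1 and §3 Claim 3.1]
[cite: Novario2026HodgeClassesHilbertSquares, Prop. 4.1–4.4] [cite: VoisinHodgeII2003, Prop. 9.20] -/
theorem isotropicClass_mem_algebraicClasses
    (hV : VerbitskyGuan_cohomology_K3HilbertSquareType) (hO : OGrady2008_dualBBFClass_algebraic)
    (hX : IsSmoothProjective 4 X) (hK : IsOfK3HilbertSquareType X) (hM : MarkedK3Sq[X, φ, P, z])
    {lam : complexBetti X (2 * 2)} (hrat : IsRationalClass lam) (hH : IsOfHodgeType 4 X (2 * 2) 2 2 lam)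
    (hiso : Cup3[lam, (LinearEquiv.symm φ) z, (LinearEquiv.symm φ) (star z)] = 0) :
    lam ∈ algebraicClasses X 2 := by
  classical
  obtain ⟨h1, h2, h3, -⟩ := id hM
  have hmk : IsMarkedK3Hilb 2 X φ P := isMarkedK3Hilb_of_marked hM
  obtain ⟨F, hF⟩ := exists_classEndomorphism hX hM lam
  haveI : FiniteDimensional ℂ (complexBetti X 2) := LinearEquiv.finiteDimensional φ.symm
  set N : Submodule ℂ (complexBetti X 2) := algebraicClasses X 1 with hNdef
  have hFN : ∀ y, F y ∈ N := classEndomorphism_mem_algebraicClasses hX hM hF hrat hH hiso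
  -- the form `q_X = q ∘ (φ × φ)` on `H²(X)`
  set qX : LinearMap.BilinForm ℂ (complexBetti X 2) :=
    (qC).compl₁₂ (φ : complexBetti X 2 →ₗ[ℂ] (K3HilbertIndex → ℂ))
      (φ : complexBetti X 2 →ₗ[ℂ] (K3HilbertIndex → ℂ)) with hqXdef
  have hqX : ∀ x y, qX x y = k3HilbertForm 2 (φ x) (φ y) := fun x y => by
    rw [hqXdef, LinearMap.compl₁₂_apply, qC_apply]; rfl
  have hqXrefl : qX.IsRefl := fun x y h => by rw [hqX] at h ⊢; rwa [k3HilbertForm_comm]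
  have hqXsep : qX.SeparatingLeft := by
    intro x hx
    have hφ : φ x = 0 := by
      refine qC_nondegenerate.1 _ fun v => ?_
      have h := hx (φ.symm v)
      rw [hqX, LinearEquiv.apply_symm_apply] at h
      rw [qC_apply, h]
    exact φ.injective (by rw [hφ, map_zero])
  have hqXnd : qX.Nondegenerate := (LinearMap.IsRefl.nondegenerate_iff_separatingLeft hqXrefl).2 hqXsep
  -- a basis of `N` and the coordinates of `F`
  set n := Module.finrank ℂ N with hndef
  let b : Basis (Fin n) ℂ N := Module.finBasis ℂ N
  let Fr : complexBetti X 2 →ₗ[ℂ] N := LinearMap.codRestrict N F hFN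
  let f : Fin n → (complexBetti X 2 →ₗ[ℂ] ℂ) := fun k => (b.coord k) ∘ₗ Fr
  have hFsum : ∀ y, F y = ∑ k, f k y • (b k : complexBetti X 2) := by
    intro y
    have h := congrArg (N.subtype : N →ₗ[ℂ] complexBetti X 2) (b.sum_repr (Fr y)).symm
    rw [map_sum] at h
    simpa [Fr, f, Basis.coord_apply] using h
  -- Riesz vectors `aₖ` with `q(φ aₖ, φ y) = fₖ(y)`
  let a : Fin n → complexBetti X 2 := fun k =>
    φ.symm (((qC).toDual qC_nondegenerate).symm ((f k) ∘ₗ (φ.symm : (K3HilbertIndex → ℂ) →ₗ[ℂ] complexBetti X 2)))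
  have ha : ∀ k y, k3HilbertForm 2 (φ (a k)) (φ y) = f k y := by
    intro k y
    rw [← qC_apply]
    simp only [a, LinearEquiv.apply_symm_apply]
    rw [LinearMap.BilinForm.apply_toDual_symm_apply, LinearMap.comp_apply, LinearEquiv.coe_coe,
      LinearEquiv.symm_apply_apply]
  -- `aₖ ∈ N` : `aₖ ∈ N^{⊥⊥}` because `F` kills `N^⊥`
  have haN : ∀ k, a k ∈ N := by
    intro k
    rw [← LinearMap.BilinForm.orthogonal_orthogonal hqXnd hqXrefl N, LinearMap.BilinForm.mem_orthogonal_iff]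
    intro t ht
    rw [LinearMap.BilinForm.mem_orthogonal_iff] at ht
    have ht' : ∀ e : complexBetti X 2, e ∈ algebraicClasses X 1 → k3HilbertForm 2 (φ t) (φ e) = 0 :=
      fun e he => by rw [k3HilbertForm_comm, ← hqX]; exact ht e he
    have hFt : F t = 0 := classEndomorphism_eq_zero_of_orthogonal hX hM hF hrat hH hiso ht'
    have hFrt : Fr t = 0 := Subtype.ext (by simp [Fr, hFt])
    rw [hqX, k3HilbertForm_comm, ha]
    simp [f, hFrt]
  -- the algebraic class `λ' = Σ aₖ ∪ dₖ`
  set lam' : complexBetti X (2 * 2) := ∑ k, cupProduct (rfl : 2 + 2 = 2 * 2) (a k) (b k : complexBetti X 2)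
    with hlam'def
  have hlam'alg : lam' ∈ algebraicClasses X 2 := by
    refine Submodule.sum_mem _ fun k _ => ?_
    have h := Voisin2003_cupProduct_algebraicClasses_holds' hX (haN k) (b k).2
    exact h
  -- its cubic form
  set c₀ : ℂ := ∑ k, k3HilbertForm 2 (φ (a k)) (φ (b k : complexBetti X 2)) with hc₀def
  have hqF : ∀ y w : complexBetti X 2, k3HilbertForm 2 (φ (F y)) (φ w) =
      ∑ k, k3HilbertForm 2 (φ (a k)) (φ y) * k3HilbertForm 2 (φ (b k : complexBetti X 2)) (φ w) := by
    intro y w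
    rw [← hqX, hFsum y, map_sum, LinearMap.sum_apply]
    refine Finset.sum_congr rfl fun k _ => ?_
    rw [map_smul, LinearMap.smul_apply, smul_eq_mul, hqX, ha]
  have hcub' : ∀ y w : complexBetti X 2, Cup3[lam', y, w] =
      (c₀ * k3HilbertForm 2 (φ y) (φ w) + 2 * k3HilbertForm 2 (φ (F y)) (φ w)) • P := by
    intro y w
    have hFwy : k3HilbertForm 2 (φ (F w)) (φ y) = k3HilbertForm 2 (φ (F y)) (φ w) := by
      rw [k3HilbertForm_comm, ← classEndomorphism_selfAdjoint hX hM hF]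
    simp only [hlam'def, map_sum, LinearMap.sum_apply]
    simp_rw [← cupFour_def, cupFour_eq_of_isMarkedK3Hilb hmk, ← Finset.sum_smul]
    congr 1
    rw [two_mul, ← add_assoc]
    nth_rewrite 2 [← hFwy]
    rw [hqF y w, hqF w y, hc₀def, Finset.sum_mul, ← Finset.sum_add_distrib, ← Finset.sum_add_distrib]
  -- O'Grady's class
  obtain ⟨qd, hqdalg, -, hqd⟩ := hO.exists_cup_cup_eq_of_clauses hX hK h1 h2 h3
  -- the candidate `λ'' = ½ λ' − (c₀/50) q^∨` has the cubic form of `λ`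
  have hEq : lam = ((1 : ℂ) / 2) • lam' - (c₀ / 50) • qd := by
    refine eq_of_cup3_eq hV hX hK fun y w => ?_
    simp only [map_sub, map_smul, LinearMap.sub_apply, LinearMap.smul_apply]
    rw [hF, hcub', hqd, smul_smul, smul_smul, ← sub_smul]
    congr 1
    ring
  rw [hEq]
  exact Submodule.sub_mem _ (Submodule.smul_mem _ _ hlam'alg) (Submodule.smul_mem _ _ hqdalg)

end Summit.HodgeConjecture.HodgeConjecture.Theorems.MarkmanPartnerTransport.PartnerLattice

end
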